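import Summits.AtomisticToContinuum.Crystallization.Theses.PalmUnimodularRigidity
import Summits.AtomisticToContinuum.Crystallization.Theorems.MinimiserShells.Negative.LoadBearing
import Summits.AtomisticToContinuum.Crystallization.Theorems.MinimiserShells.Negative.Rootedness
import Summits.AtomisticToContinuum.Crystallization.Theorems.PalmUnimodularRigidityMinimiserShellsDeepBadPricingOfShellNoBoundary
import Literature.MathematicalPhysics.StatisticalMechanics.LennardJonesClusters

/-!
# Passing to a separated sub-configuration loses at most `616` bad shells per removed point (stub `stub_sepReduction_bad`, S15d)

Stub `stub_sepReduction_bad` (S15d) of line `equilibrium-in-law-surgery` (reshape r6, the hard-core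
reduction) of crux `MinimiserShells` (stmt-AtomisticToContinuum-9225, route
`PalmUnimodularRigidity`).

Let `Z ⊆ C` be finite configurations in `ℝ³` with `Z` `1/3`-separated, and call a site `x` of a
finite configuration `X` BADLY SHELLED in `X` if `¬ GoodShell (count|((· − x) '' X))`.  Then
`#{x ∈ C badly shelled in C} ≤ #{x ∈ Z badly shelled in Z} + 616 · (#C − #Z)`.

Proof.  Write `M = C ∖ Z` (`#M = #C − #Z`).  A badly-shelled site of `C` is either a point of `M`,
or a point of `Z` within distance `5/4` of some point of `M`, or a point `x ∈ Z` with no point of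
`M` in `B̄(x, 5/4)`; in the last case `C` and `Z` have the same points in `B̄(x, 5/4)`, so the
re-rooted counting measures `count|((· − x) '' C)` and `count|((· − x) '' Z)` have the same atoms in
`B̄(0, 5/4)` (`count_restrict_image_sub_singleton_ne_zero_iff`) and `x` is badly shelled in `Z` by
the locality of the shell predicate (`goodShell_congr_of_local`; `goodShell_congr_of_far` below).
Finally, for each `p ∈ M` the points of the `1/3`-separated set `Z` within `5/4` of `p` number at
most `(2 · (5/4) / (1/3) + 1)³ = (17/2)³ < 615` (`card_le_of_separated_of_dist_le`,
`finrank_euclideanSpace_fin`; `card_filter_dist_le_le` below), so the middle class has at most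
`615 · #M` points (`card_filter_bad_le`, the `Finset.filter` form of the stub).
-/

noncomputable section

open MeasureTheory
open scoped ENNReal BigOperators Classical

namespace Summit.AtomisticToContinuum.Crystallization.Theorems.PalmUnimodularRigidityMinimiserShells.SepReductionBad

open Literature.MathematicalPhysics.StatisticalMechanics (card_le_of_separated_of_dist_le)
open Summit.AtomisticToContinuum.Crystallization.Theorems.MinimiserShells.Negative.LoadBearing (GoodShell)
open Summit.AtomisticToContinuum.Crystallization.Theorems.MinimiserShells.Negative.Rootedness (E3)
open Summit.AtomisticToContinuum.Crystallization.Theorems.PalmUnimodularRigidityMinimiserShells.ShellNoBoundary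
  (goodShell_congr_of_local count_restrict_image_sub_singleton_ne_zero_iff)

/-! ## Counting the elements of a Finset satisfying a predicate -/

/-- The number of elements of (the type of) a Finset `s` satisfying `P` is `#(s.filter P)`. -/
theorem natCard_subtype_eq_card_filter {α : Type*} (s : Finset α) (P : α → Prop)
    [DecidablePred P] : Nat.card {x : s // P x} = (s.filter P).card := by
  rw [← Nat.card_eq_finsetCard]
  exact Nat.card_congr ((Equiv.subtypeSubtypeEquivSubtypeInter (· ∈ s) P).trans
    (Equiv.subtypeEquivRight fun x => Finset.mem_filter.symm))

/-! ## Packing: few points of a separated set near a given point -/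

/-- At most `615` points of a `1/3`-separated finite set `Z ⊆ ℝ³` lie within distance `5/4` of a
given point `p`: by the packing bound `card_le_of_separated_of_dist_le` they number at most
`(2 · (5/4) / (1/3) + 1)³ = 614.125`. -/
theorem card_filter_dist_le_le (Z : Finset E3)
    (hZ : ∀ x ∈ Z, ∀ z ∈ Z, x ≠ z → (1 : ℝ) / 3 ≤ dist x z) (p : E3) :
    (Z.filter fun x => dist x p ≤ 5 / 4).card ≤ 615 := by
  have h := card_le_of_separated_of_dist_le (Z.filter fun x => dist x p ≤ 5 / 4) p
    (r := 1 / 3) (R := 5 / 4) (by norm_num) (by norm_num)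
    (fun c hc => (Finset.mem_filter.1 hc).2)
    (fun c hc d hd hcd => hZ c (Finset.mem_filter.1 hc).1 d (Finset.mem_filter.1 hd).1 hcd)
  rw [finrank_euclideanSpace_fin] at h
  have h' : ((Z.filter fun x => dist x p ≤ 5 / 4).card : ℝ) ≤ 615 := h.trans (by norm_num)
  exact_mod_cast h'

/-! ## Locality: a bad site of `C` far from the removed points is a bad site of `Z` -/

/-- If `Z ⊆ C` and no point of `C ∖ Z` lies within distance `5/4` of `x`, then the re-rooted
counting measures of `C` and of `Z` at `x` have the same atoms in the closed ball `B̄(0, 5/4)`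
(`count_restrict_image_sub_singleton_ne_zero_iff`), so `x` is well shelled in `C` iff it is well
shelled in `Z` (`goodShell_congr_of_local`). -/
theorem goodShell_congr_of_far {C Z : Finset E3} (hZC : Z ⊆ C) {x : E3}
    (hfar : ∀ p ∈ C \ Z, ¬ dist x p ≤ 5 / 4) :
    GoodShell ((Measure.count : Measure E3).restrict ((fun z => z - x) '' (↑C : Set E3))) ↔
      GoodShell ((Measure.count : Measure E3).restrict ((fun z => z - x) '' (↑Z : Set E3))) := by
  refine goodShell_congr_of_local fun w hw => ?_
  rw [count_restrict_image_sub_singleton_ne_zero_iff, count_restrict_image_sub_singleton_ne_zero_iff,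
    Finset.mem_coe, Finset.mem_coe]
  refine ⟨fun hC => ?_, fun hZ => hZC hZ⟩
  by_contra hxZ
  refine hfar (w + x) (Finset.mem_sdiff.2 ⟨hC, hxZ⟩) ?_
  rw [dist_comm, dist_eq_norm, add_sub_cancel_right]
  exact hw

/-! ## The count, in `Finset.filter` form -/

/-- **The stub in `Finset.filter` form.** For `Z ⊆ C` finite with `Z` `1/3`-separated,
`#{x ∈ C : x badly shelled in C} ≤ #{x ∈ Z : x badly shelled in Z} + 616 · #(C ∖ Z)`: the bad
sites of `C` are covered by `C ∖ Z`, the bad sites of `Z`, and the points of `Z` within `5/4` of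
`C ∖ Z` (`goodShell_congr_of_far`), and the last class has at most `615 · #(C ∖ Z)` points
(`card_filter_dist_le_le`). -/
theorem card_filter_bad_le (C Z : Finset E3) (hZC : Z ⊆ C)
    (hZ : ∀ x ∈ Z, ∀ z ∈ Z, x ≠ z → (1 : ℝ) / 3 ≤ dist x z) :
    (C.filter fun x => ¬ GoodShell ((Measure.count : Measure E3).restrict
        ((fun z => z - x) '' (↑C : Set E3)))).card ≤
      (Z.filter fun x => ¬ GoodShell ((Measure.count : Measure E3).restrict
        ((fun z => z - x) '' (↑Z : Set E3)))).card + 616 * (C \ Z).card := by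
  set BC := C.filter fun x => ¬ GoodShell ((Measure.count : Measure E3).restrict
    ((fun z => z - x) '' (↑C : Set E3))) with hBC
  set BZ := Z.filter fun x => ¬ GoodShell ((Measure.count : Measure E3).restrict
    ((fun z => z - x) '' (↑Z : Set E3))) with hBZ
  set near : E3 → Prop := fun x => ∃ p ∈ C \ Z, dist x p ≤ 5 / 4 with hnear
  -- the bad sites of `C` are removed points, bad sites of `Z`, or points of `Z` near a removed point
  have hcover : BC ⊆ (C \ Z) ∪ BZ ∪ Z.filter near := by
    intro x hx
    obtain ⟨hxC, hbad⟩ := Finset.mem_filter.1 hx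
    rw [Finset.mem_union, Finset.mem_union]
    by_cases hxZ : x ∈ Z
    · by_cases hn : near x
      · exact Or.inr (Finset.mem_filter.2 ⟨hxZ, hn⟩)
      · refine Or.inl (Or.inr (Finset.mem_filter.2 ⟨hxZ, fun hgood => hbad ?_⟩))
        exact (goodShell_congr_of_far hZC fun p hp hle => hn ⟨p, hp, hle⟩).2 hgood
    · exact Or.inl (Or.inl (Finset.mem_sdiff.2 ⟨hxC, hxZ⟩))
  -- the points of `Z` near a removed point, counted through the removed points
  have hnearZ : Z.filter near ⊆ (C \ Z).biUnion fun p => Z.filter fun x => dist x p ≤ 5 / 4 := by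
    intro x hx
    obtain ⟨hxZ, p, hp, hle⟩ := Finset.mem_filter.1 hx
    exact Finset.mem_biUnion.2 ⟨p, hp, Finset.mem_filter.2 ⟨hxZ, hle⟩⟩
  have hnear_card : (Z.filter near).card ≤ (C \ Z).card * 615 :=
    (Finset.card_le_card hnearZ).trans
      (Finset.card_biUnion_le_card_mul _ _ _ fun p _ => card_filter_dist_le_le Z hZ p)
  calc BC.card ≤ ((C \ Z) ∪ BZ ∪ Z.filter near).card := Finset.card_le_card hcover
    _ ≤ ((C \ Z) ∪ BZ).card + (Z.filter near).card := Finset.card_union_le _ _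
    _ ≤ (C \ Z).card + BZ.card + (C \ Z).card * 615 :=
        add_le_add (Finset.card_union_le _ _) hnear_card
    _ = BZ.card + 616 * (C \ Z).card := by ring

/-! ## The stub -/

/-- **Stub `stub_sepReduction_bad` (S15d) of line `equilibrium-in-law-surgery` (reshape r6).**
Removing points from a finite configuration `C` down to a `1/3`-separated sub-configuration `Z ⊆ C`
lowers the number of badly-shelled sites by at most `616` per removed point: a site `x ∈ Z` that is
badly shelled in `C` is badly shelled in `Z` unless some removed point lies within `5/4` of `x`
(locality of `GoodShell`, `goodShell_congr_of_far`), at most `(17/2)³ < 615` points of the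
`1/3`-separated set `Z` lie within `5/4` of a given removed point (`card_filter_dist_le_le`), and the
removed points themselves number `#C − #Z` (`card_filter_bad_le`, `natCard_subtype_eq_card_filter`). -/
theorem stub_sepReduction_bad :
    ∀ C Z : Finset (EuclideanSpace ℝ (Fin 3)), Z ⊆ C →
      (∀ x ∈ Z, ∀ z ∈ Z, x ≠ z → (1 : ℝ) / 3 ≤ dist x z) →
      (Nat.card {x : C // ¬ GoodShell ((Measure.count : Measure (EuclideanSpace ℝ (Fin 3))).restrict
          ((fun z => z - (x : EuclideanSpace ℝ (Fin 3))) '' (↑C : Set (EuclideanSpace ℝ (Fin 3)))))} : ℝ) ≤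
        (Nat.card {x : Z // ¬ GoodShell ((Measure.count : Measure (EuclideanSpace ℝ (Fin 3))).restrict
          ((fun z => z - (x : EuclideanSpace ℝ (Fin 3))) '' (↑Z : Set (EuclideanSpace ℝ (Fin 3)))))} : ℝ) +
          616 * ((C.card : ℝ) - (Z.card : ℝ)) := by
  intro C Z hZC hsep
  have hC : Nat.card {x : C // ¬ GoodShell ((Measure.count : Measure (EuclideanSpace ℝ (Fin 3))).restrict
      ((fun z => z - (x : EuclideanSpace ℝ (Fin 3))) '' (↑C : Set (EuclideanSpace ℝ (Fin 3)))))} =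
      (C.filter fun x => ¬ GoodShell ((Measure.count : Measure E3).restrict
        ((fun z => z - x) '' (↑C : Set E3)))).card :=
    natCard_subtype_eq_card_filter C fun x => ¬ GoodShell ((Measure.count : Measure E3).restrict
      ((fun z => z - x) '' (↑C : Set E3)))
  have hZ : Nat.card {x : Z // ¬ GoodShell ((Measure.count : Measure (EuclideanSpace ℝ (Fin 3))).restrict
      ((fun z => z - (x : EuclideanSpace ℝ (Fin 3))) '' (↑Z : Set (EuclideanSpace ℝ (Fin 3)))))} =
      (Z.filter fun x => ¬ GoodShell ((Measure.count : Measure E3).restrict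
        ((fun z => z - x) '' (↑Z : Set E3)))).card :=
    natCard_subtype_eq_card_filter Z fun x => ¬ GoodShell ((Measure.count : Measure E3).restrict
      ((fun z => z - x) '' (↑Z : Set E3)))
  have hM : ((C \ Z).card : ℝ) = (C.card : ℝ) - (Z.card : ℝ) := by
    rw [eq_sub_iff_add_eq]
    exact_mod_cast Finset.card_sdiff_add_card_eq_card hZC
  have key := card_filter_bad_le C Z hZC hsep
  rw [hC, hZ, ← hM]
  exact_mod_cast key

end Summit.AtomisticToContinuum.Crystallization.Theorems.PalmUnimodularRigidityMinimiserShells.SepReductionBad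

end
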